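import Summits.ValiantsHypothesis.ValiantsHypothesis.Theorems.KPlusLogSqLawTropicalBThreeContact

/-!
# Route «KPlusLogSqLaw», crux `TropicalB` (stmt-ValiantsHypothesis-19771) — THE HUB LAW: all single-token activations over a common base
# deviate at ONE common column (the exchange cycles over a state pass through a hub)

HONEST FRAMING.  Helper toward the registered stubs `stub_tropThin` / `stub_tropFat` of `Cruxes/TropicalB/Lines/birth.lean` (crux
`Summit.ValiantsHypothesis.ValiantsHypothesis.Theses.KPlusLogSqLaw.TropicalB`, item stmt-ValiantsHypothesis-19771, route KPlusLogSqLaw;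
cell `pub-symmetroid`, seat val-sym-trop-p5 g26, refuter-adjacent lane, 2026-08-29; `--supports … --as helper`).  A STRUCTURE law about
unique optima (`IsDominant`) of an ARBITRARY dominance design; nothing here bounds `TropicalB`, and nothing bears on `WeakLifting`,
DoorA26 / DoorA34, `MatrixDescartes` (stmt-ValiantsHypothesis-18050) or VP ≠ VNP.

THE LAW (`hub`, `hub_law`).  `B` a unique optimum; `P j` (`j` in a nonempty finite family) SINGLE-TOKEN ACTIVATIONS over `B` (classes =
those of `B` off one column `e j` each, where the exponent goes up; e.g. all `M_{S+x}`, `x ∉ S`, over `M_S` in a radix-2 odometer whose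
activations are clean).  THEN THERE IS A COLUMN AT WHICH EVERY `P j` DEVIATES FROM `B` — a HUB through which all exchange cycles pass.  (Line 4
of memo HOME/val-sym-trop-p5/g25/CONTACT-LAWS-g25.md, there «paper modulo the wrap case and modulo C2»; located there and in
HOME/val-sym-trop-p5/g26/exp/hub_check.py: 57/57 resp. 43/43 states of the cell's kernel cubes; in the 6-cube s204 every activation over `∅` is
the one-column flip at the hub `(1,1)`.)

PROOF.  Induction on the size of the family: 1, 2, 3 activations are `dev_token`, `contact_nonempty`, `three_contact` (…TropicalBThreeContact).
For ≥ 4 activations without a hub, the subfamilies missing one activation `x` each have a hub `h_x` (induction), off `x`'s cycle; four of them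
form the configuration excluded by the **FOUR-POINT LEMMA** (`four_point`): three activations `X, Y, W` with a common column `h` never have
columns `a` (on `Y`, `W`, off `X`), `b` (on `X`, `W`, off `Y`), `c` (on `X`, `Y`, off `W`) all at once — «merging is a tree and splitting is a
tree».  Its proof chases the **ARC LEMMA** (`arc_shared` / `arc_avoids`: a run of `U`'s cycle between two common columns of `U`, `V` that
avoids a column of `U` off `V` consists of SHARED columns — in the coordinates from the entry column (`first_hit`, `entry_unique`, `tail_avoids`
of …TropicalBContactStretch) the contact is an initial segment, shared except at its end — so `V`'s cycle traces the same columns) around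
`W → Y → X → W`, and compares the two orientations of `W`'s cycle (`cyc_total`, `cyc_rotate`, `cyc_rotate'`, `cyc_antisymm`: «`q` is reached
from `p` before `r`» along one cycle).  No valuation argument beyond the laws already landed enters: given the single-contact and
three-contact laws, the hub law is pure cycle combinatorics.

[this cell; folklore ingredients]
-/

set_option linter.dupNamespace false
set_option autoImplicit false

namespace Summit.ValiantsHypothesis.ValiantsHypothesis.Theorems.KPlusLogSqLaw

namespace SingleContact

/-! ## 11. Cyclic order along one cycle: «q is reached from p before r» -/

section Cyclic

variable {m : ℕ} (ρ : Equiv.Perm (Fin m))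

/-- iterates add. [elementary] -/
theorem pow_add_apply (p : Fin m) (a b : ℕ) : (ρ ^ (a + b)) p = (ρ ^ a) ((ρ ^ b) p) := by
  rw [pow_add, Equiv.Perm.mul_apply]

/-- **totality**: of two other points of the cycle of `p`, one is reached first. [elementary] -/
theorem cyc_total {p q r : Fin m} (hq : ρ.SameCycle p q) (hr : ρ.SameCycle p r) (hqr : q ≠ r) :
    (∃ n, (ρ ^ n) p = q ∧ ∀ t, t ≤ n → (ρ ^ t) p ≠ r) ∨ (∃ n, (ρ ^ n) p = r ∧ ∀ t, t ≤ n → (ρ ^ t) p ≠ q) := by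
  obtain ⟨j, hj, hjq⟩ := exists_coord ρ p hq
  obtain ⟨s, hs, hsr⟩ := exists_coord ρ p hr
  have hjs : j ≠ s := by rintro rfl; exact hqr (hjq.symm.trans hsr)
  rcases Nat.lt_or_gt_of_ne hjs with h | h
  · left
    refine ⟨j, hjq, fun t ht heq => ?_⟩
    have := pow_apply_injOn ρ p (lt_of_le_of_lt ht hj) hs (heq.trans hsr.symm)
    omega
  · right
    refine ⟨s, hsr, fun t ht heq => ?_⟩
    have := pow_apply_injOn ρ p (lt_of_le_of_lt ht hs) hj (heq.trans hjq.symm)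
    omega

/-- **antisymmetry**: `q` before `r` and `r` before `q` from the same point is absurd. [elementary] -/
theorem cyc_antisymm {p q r : Fin m} (h₁ : ∃ n, (ρ ^ n) p = q ∧ ∀ t, t ≤ n → (ρ ^ t) p ≠ r)
    (h₂ : ∃ n, (ρ ^ n) p = r ∧ ∀ t, t ≤ n → (ρ ^ t) p ≠ q) : False := by
  obtain ⟨n, hn, h1⟩ := h₁
  obtain ⟨n', hn', h2⟩ := h₂
  rcases le_or_gt n n' with h | h
  · exact h2 n h hn
  · exact h1 n' h.le hn'

/-- **rotation** (`r ∉ [p → q]` gives `p ∉ [q → r]`). [elementary] -/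
theorem cyc_rotate {p q r : Fin m} (h : ∃ n, (ρ ^ n) p = q ∧ ∀ t, t ≤ n → (ρ ^ t) p ≠ r) (hr : ρ.SameCycle p r)
    (hpq : p ≠ q) : ∃ n, (ρ ^ n) q = r ∧ ∀ t, t ≤ n → (ρ ^ t) q ≠ p := by
  obtain ⟨n, hn, h1⟩ := h
  obtain ⟨s, hs, hsr⟩ := exists_coord ρ p hr
  have hns : n < s := by
    by_contra hle
    exact h1 s (by omega) hsr
  have hn0 : 0 < n := by
    rcases Nat.eq_zero_or_pos n with h0 | h0
    · rw [h0, pow_zero, Equiv.Perm.one_apply] at hn; exact absurd hn hpq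
    · exact h0
  refine ⟨s - n, ?_, fun t ht heq => ?_⟩
  · rw [← hn, ← pow_add_apply, show s - n + n = s by omega, hsr]
  · rw [← hn, ← pow_add_apply] at heq
    have h0 : (ρ ^ (t + n)) p = (ρ ^ 0) p := by rw [heq, pow_zero, Equiv.Perm.one_apply]
    have := pow_apply_injOn ρ p (by omega) (by omega) h0
    omega

/-- **rotation, second form** (`r ∉ [p → q]` gives `q ∉ [r → p]`). [elementary] -/
theorem cyc_rotate' {p q r : Fin m} (h : ∃ n, (ρ ^ n) p = q ∧ ∀ t, t ≤ n → (ρ ^ t) p ≠ r) (hr : ρ.SameCycle p r)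
    (hpq : p ≠ q) : ∃ n, (ρ ^ n) r = p ∧ ∀ t, t ≤ n → (ρ ^ t) r ≠ q := by
  obtain ⟨n, hn, h1⟩ := h
  obtain ⟨s, hs, hsr⟩ := exists_coord ρ p hr
  have hns : n < s := by
    by_contra hle
    exact h1 s (by omega) hsr
  have hn0 : 0 < n := by
    rcases Nat.eq_zero_or_pos n with h0 | h0
    · rw [h0, pow_zero, Equiv.Perm.one_apply] at hn; exact absurd hn hpq
    · exact h0
  refine ⟨Function.minimalPeriod ρ p - s, ?_, fun t ht heq => ?_⟩
  · rw [← hsr, ← pow_add_apply, show Function.minimalPeriod ρ p - s + s = Function.minimalPeriod ρ p by omega]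
    exact pow_minimalPeriod_apply ρ p
  · rw [← hsr, ← pow_add_apply, ← hn] at heq
    rcases Nat.lt_or_ge (t + s) (Function.minimalPeriod ρ p) with hlt | hge
    · have := pow_apply_injOn ρ p hlt (by omega) heq
      omega
    · have hts : t + s = Function.minimalPeriod ρ p := by omega
      rw [hts, pow_minimalPeriod_apply] at heq
      have h0 : (ρ ^ 0) p = (ρ ^ n) p := by rw [pow_zero, Equiv.Perm.one_apply]; exact heq
      have := pow_apply_injOn ρ p (minimalPeriod_pos ρ p) (by omega) h0
      omega

end Cyclic

/-! ## 12. The arc lemma: a run of one cycle between two common columns that avoids a private column is shared -/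

section Arc

open Summit.ValiantsHypothesis.ValiantsHypothesis.Theorems.MatrixDescartes.Negative
open Summit.ValiantsHypothesis.ValiantsHypothesis.Theorems.LacunarySymmetroidMatrixDescartes
open Finset

variable {m K : ℕ} (d : Fin K → ℕ) (v ε : Fin m → Fin m → Fin K → ℤ)

/-- **ARC LEMMA.**  `U`, `V` single-token activations over `B`; `p`, `q` common columns; `r` a column of `U`'s cycle off `V`'s.  If the run
of `U`'s cycle from `p` to `q` (in `n` steps) avoids `r`, then every column of the run before `q` is SHARED (same cell in `U` and `V`):
in the coordinates from the entry column the contact is an initial segment, shared except at its last column, and the run cannot wrap past `r`.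
[this cell] -/
theorem arc_shared {θB θU θV : ℤ} {B U V : Equiv.Perm (Fin m) × (Fin m → Fin K)}
    (hB : IsDominant d v ε θB B) (hU : IsDominant d v ε θU U) (hV : IsDominant d v ε θV V) (eU eV : Fin m)
    (hcU : ∀ i, i ≠ eU → d (U.2 i) = d (B.2 i)) (hcV : ∀ i, i ≠ eV → d (V.2 i) = d (B.2 i))
    (hδU : d (B.2 eU) < d (U.2 eU)) (hδV : d (B.2 eV) < d (V.2 eV)) {p q r : Fin m}
    (hpU : ¬ (U.1 p = B.1 p ∧ U.2 p = B.2 p)) (hpV : ¬ (V.1 p = B.1 p ∧ V.2 p = B.2 p))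
    (hqV : ¬ (V.1 q = B.1 q ∧ V.2 q = B.2 q))
    (hrU : ¬ (U.1 r = B.1 r ∧ U.2 r = B.2 r)) (hrV : V.1 r = B.1 r ∧ V.2 r = B.2 r)
    {n : ℕ} (hn : ((B.1⁻¹ * U.1) ^ n) p = q) (hpath : ∀ t, t ≤ n → ((B.1⁻¹ * U.1) ^ t) p ≠ r) :
    ∀ t, t < n → U.1 (((B.1⁻¹ * U.1) ^ t) p) = V.1 (((B.1⁻¹ * U.1) ^ t) p) ∧ U.2 (((B.1⁻¹ * U.1) ^ t) p) = V.2 (((B.1⁻¹ * U.1) ^ t) p) := by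
  classical
  -- the entry column `u` of the contact, reached from `r`
  obtain ⟨m₀, -, -, hudev, -, huentry⟩ := first_hit d v ε hB hU eU hcU hδU (Q := V) (u := r) (c₀ := p) hrU hrV hpU hpV
  set u : Fin m := ((B.1⁻¹ * U.1) ^ m₀) r with hudef
  have huU : ¬ (U.1 u = B.1 u ∧ U.2 u = B.2 u) := coord_dev hrU m₀
  clear_value u
  -- coordinates from `u`
  set N : ℕ := Function.minimalPeriod (B.1⁻¹ * U.1) u with hNdef
  set col : ℕ → Fin m := fun t => ((B.1⁻¹ * U.1) ^ t) u with hcol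
  have c0 : col 0 = u := by simp [hcol]
  have cN : col N = u := by simp only [hcol]; exact pow_minimalPeriod_apply _ u
  have cs : ∀ t, B.1.symm (U.1 (col t)) = col (t + 1) := fun t => by simp only [hcol]; rw [pow_succ_apply]; rfl
  have ci : ∀ t t', t < N → t' < N → col t = col t' → t = t' := fun t t' ht ht' h => pow_apply_injOn _ u ht ht' h
  have cdev : ∀ t, ¬ (U.1 (col t) = B.1 (col t) ∧ U.2 (col t) = B.2 (col t)) := fun t => by simp only [hcol]; exact coord_dev huU t
  have ccov : ∀ c, ¬ (U.1 c = B.1 c ∧ U.2 c = B.2 c) → ∃ t, t < N ∧ col t = c :=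
    fun c hc => coord_exists d v ε hB hU eU hcU hδU huU hc
  have cadd : ∀ a b, col (a + b) = ((B.1⁻¹ * U.1) ^ a) (col b) := fun a b => by simp only [hcol]; exact pow_add_apply _ u a b
  have hNpos : 0 < N := minimalPeriod_pos _ u
  -- exit time `M`: the contact is `col '' [0, M)`, shared below `M - 1`
  obtain ⟨tr, htr, hctr⟩ := ccov r hrU
  have hex : ∃ t, V.1 (col t) = B.1 (col t) ∧ V.2 (col t) = B.2 (col t) := ⟨tr, by rw [hctr]; exact hrV⟩
  set M := Nat.find hex with hM
  have hMspec : V.1 (col M) = B.1 (col M) ∧ V.2 (col M) = B.2 (col M) := Nat.find_spec hex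
  have hMle : M ≤ tr := Nat.find_min' hex (by rw [hctr]; exact hrV)
  have hMpos : 0 < M := by
    rw [Nat.pos_iff_ne_zero]; intro h0
    rw [h0, c0] at hMspec; exact hudev hMspec
  have hin : ∀ t, t < M → ¬ (V.1 (col t) = B.1 (col t) ∧ V.2 (col t) = B.2 (col t)) := fun t ht => Nat.find_min hex ht
  have hout : ∀ t, M ≤ t → t < N → V.1 (col t) = B.1 (col t) ∧ V.2 (col t) = B.2 (col t) := fun t h1 h2 => by
    simp only [hcol]
    exact tail_avoids d v ε hB hU hV eU eV hcU hcV hδU hδV huU hudev huentry hMpos (by simpa only [hcol] using hMspec) t h1 h2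
  have hsh : ∀ t, t + 1 < M → U.1 (col t) = V.1 (col t) ∧ U.2 (col t) = V.2 (col t) := by
    intro t ht
    by_contra hns
    have h' : ∀ w, ¬ (U.1 w = B.1 w ∧ U.2 w = B.2 w) → (U.1 w = V.1 w ∧ U.2 w = V.2 w) → B.1.symm (U.1 w) ≠ col (t + 1) := by
      intro w _ hws heq
      rw [← cs] at heq
      have hw : w = col t := U.1.injective (B.1.symm.injective heq)
      rw [hw] at hws
      exact hns hws
    have heq := entry_unique d v ε hB hU hV eU eV hcU hcV hδU hδV (cdev (t + 1)) (hin (t + 1) ht) huU hudev h' huentry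
    rw [← c0] at heq
    have := ci (t + 1) 0 (by omega) hNpos heq
    omega
  -- coordinates of `p`, `q`, and the run
  obtain ⟨i, hi, hcip⟩ := ccov p hpU
  have hiM : i < M := by
    by_contra hge
    exact hpV (hcip ▸ hout i (by omega) hi)
  have hrun : ∀ t, ((B.1⁻¹ * U.1) ^ t) p = col (t + i) := fun t => by rw [cadd, hcip]
  have hni : n + i < tr := by
    by_contra hge
    obtain ⟨t, ht⟩ : ∃ t, t + i = tr := ⟨tr - i, by omega⟩
    exact hpath t (by omega) (by rw [hrun, ht, hctr])
  have hnj : n + i < M := by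
    by_contra hge
    have := hout (n + i) (by omega) (by omega)
    rw [← hrun, hn] at this
    exact hqV this
  intro t ht
  rw [hrun]
  exact hsh (t + i) (by omega)

/-- **the other cycle follows the shared run**: under the hypotheses of `arc_shared`, `V`'s cycle from `p` traces the same columns up to `q`,
so a column off `U`'s cycle is not met by `V` between `p` and `q`. [this cell] -/
theorem arc_avoids {θB θU θV : ℤ} {B U V : Equiv.Perm (Fin m) × (Fin m → Fin K)}
    (hB : IsDominant d v ε θB B) (hU : IsDominant d v ε θU U) (hV : IsDominant d v ε θV V) (eU eV : Fin m)
    (hcU : ∀ i, i ≠ eU → d (U.2 i) = d (B.2 i)) (hcV : ∀ i, i ≠ eV → d (V.2 i) = d (B.2 i))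
    (hδU : d (B.2 eU) < d (U.2 eU)) (hδV : d (B.2 eV) < d (V.2 eV)) {p q r r' : Fin m}
    (hpU : ¬ (U.1 p = B.1 p ∧ U.2 p = B.2 p)) (hpV : ¬ (V.1 p = B.1 p ∧ V.2 p = B.2 p))
    (hqV : ¬ (V.1 q = B.1 q ∧ V.2 q = B.2 q))
    (hrU : ¬ (U.1 r = B.1 r ∧ U.2 r = B.2 r)) (hrV : V.1 r = B.1 r ∧ V.2 r = B.2 r)
    (hr'U : U.1 r' = B.1 r' ∧ U.2 r' = B.2 r')
    {n : ℕ} (hn : ((B.1⁻¹ * U.1) ^ n) p = q) (hpath : ∀ t, t ≤ n → ((B.1⁻¹ * U.1) ^ t) p ≠ r) :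
    ∃ n', ((B.1⁻¹ * V.1) ^ n') p = q ∧ ∀ t, t ≤ n' → ((B.1⁻¹ * V.1) ^ t) p ≠ r' := by
  have hsh := arc_shared d v ε hB hU hV eU eV hcU hcV hδU hδV hpU hpV hqV hrU hrV hn hpath
  have hfollow : ∀ t, t ≤ n → ((B.1⁻¹ * V.1) ^ t) p = ((B.1⁻¹ * U.1) ^ t) p := by
    intro t
    induction t with
    | zero => intro; simp
    | succ t ih =>
      intro ht
      rw [pow_succ_apply, pow_succ_apply, ih (by omega)]
      show B.1.symm (V.1 _) = B.1.symm (U.1 _)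
      rw [(hsh t (by omega)).1]
  refine ⟨n, by rw [hfollow n le_rfl, hn], fun t ht heq => ?_⟩
  rw [hfollow t ht] at heq
  exact coord_dev hpU t (by rw [heq]; exact hr'U)

end Arc

/-! ## 13. The four-point lemma and THE HUB LAW -/

section Hub

open Summit.ValiantsHypothesis.ValiantsHypothesis.Theorems.MatrixDescartes.Negative
open Summit.ValiantsHypothesis.ValiantsHypothesis.Theorems.LacunarySymmetroidMatrixDescartes
open Finset

variable {m K : ℕ} (d : Fin K → ℕ) (v ε : Fin m → Fin m → Fin K → ℤ)

/-- the four-point lemma with the orientation of `W`'s cycle fixed (`a` before `b` from `h`). [this cell] -/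
theorem four_point_aux {θB θX θY θW : ℤ} {B X Y W : Equiv.Perm (Fin m) × (Fin m → Fin K)}
    (hB : IsDominant d v ε θB B) (hX : IsDominant d v ε θX X) (hY : IsDominant d v ε θY Y) (hW : IsDominant d v ε θW W)
    (eX eY eW : Fin m)
    (hcX : ∀ i, i ≠ eX → d (X.2 i) = d (B.2 i)) (hcY : ∀ i, i ≠ eY → d (Y.2 i) = d (B.2 i))
    (hcW : ∀ i, i ≠ eW → d (W.2 i) = d (B.2 i))
    (hδX : d (B.2 eX) < d (X.2 eX)) (hδY : d (B.2 eY) < d (Y.2 eY)) (hδW : d (B.2 eW) < d (W.2 eW))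
    {h a b c : Fin m}
    (hhX : ¬ (X.1 h = B.1 h ∧ X.2 h = B.2 h)) (hhY : ¬ (Y.1 h = B.1 h ∧ Y.2 h = B.2 h)) (hhW : ¬ (W.1 h = B.1 h ∧ W.2 h = B.2 h))
    (haX : X.1 a = B.1 a ∧ X.2 a = B.2 a) (haY : ¬ (Y.1 a = B.1 a ∧ Y.2 a = B.2 a))
    (hbX : ¬ (X.1 b = B.1 b ∧ X.2 b = B.2 b)) (hbY : Y.1 b = B.1 b ∧ Y.2 b = B.2 b) (hbW : ¬ (W.1 b = B.1 b ∧ W.2 b = B.2 b))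
    (hcX' : ¬ (X.1 c = B.1 c ∧ X.2 c = B.2 c)) (hcY' : ¬ (Y.1 c = B.1 c ∧ Y.2 c = B.2 c)) (hcW' : W.1 c = B.1 c ∧ W.2 c = B.2 c)
    (hab : ∃ n, ((B.1⁻¹ * W.1) ^ n) h = a ∧ ∀ t, t ≤ n → ((B.1⁻¹ * W.1) ^ t) h ≠ b) : False := by
  have hha : h ≠ a := fun hh => hhX (hh ▸ haX)
  have hch : c ≠ h := fun hh => hhW (hh ▸ hcW')
  -- S1: `Y` follows `W` from `h` to `a`; `c` (off `W`) is not met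
  obtain S1 := arc_avoids d v ε hB hW hY eW eY hcW hcY hδW hδY hhW hhY haY hbW hbY hcW' hab.choose_spec.1 hab.choose_spec.2
  -- S2: on `Y`'s cycle `a` is not between `c` and `h`; `X` follows `Y` from `c` to `h`; `b` is not met
  have hYhc : (B.1⁻¹ * Y.1).SameCycle h c :=
    (sameCycle_token d v ε hB hY eY hcY hδY hhY).trans (sameCycle_token d v ε hB hY eY hcY hδY hcY').symm
  have S2 := cyc_rotate' (B.1⁻¹ * Y.1) S1 hYhc hha
  obtain S2' := arc_avoids d v ε hB hY hX eY eX hcY hcX hδY hδX hcY' hcX' hhX haY haX hbY S2.choose_spec.1 S2.choose_spec.2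
  -- S3: on `X`'s cycle `c` is not between `h` and `b`; `W` follows `X` from `h` to `b`; `a` is not met
  have hXcb : (B.1⁻¹ * X.1).SameCycle c b :=
    (sameCycle_token d v ε hB hX eX hcX hδX hcX').trans (sameCycle_token d v ε hB hX eX hcX hδX hbX).symm
  have S3 := cyc_rotate (B.1⁻¹ * X.1) S2' hXcb hch
  obtain S3' := arc_avoids d v ε hB hX hW eX eW hcX hcW hδX hδW hhX hhW hbW hcX' hcW' haX S3.choose_spec.1 S3.choose_spec.2
  -- S4: on `W`'s cycle, `a` before `b` and `b` before `a` from `h`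
  exact cyc_antisymm (B.1⁻¹ * W.1) hab S3'

/-- **FOUR-POINT LEMMA.**  Three single-token activations `X`, `Y`, `W` over `B` with a common deviating column `h` never have all three of: a
column of `Y`'s and `W`'s cycles off `X`'s, one of `X`'s and `W`'s off `Y`'s, one of `X`'s and `Y`'s off `W`'s.  (Merging is a tree and
splitting is a tree: the contacts through `h` are stretches, so at most two of the three private pairings occur.)  Proof: chase the arcs with
`arc_avoids` around `W → Y → X → W` and compare the two orientations of `W`'s cycle (`four_point_aux`). [this cell] -/
theorem four_point {θB θX θY θW : ℤ} {B X Y W : Equiv.Perm (Fin m) × (Fin m → Fin K)}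
    (hB : IsDominant d v ε θB B) (hX : IsDominant d v ε θX X) (hY : IsDominant d v ε θY Y) (hW : IsDominant d v ε θW W)
    (eX eY eW : Fin m)
    (hcX : ∀ i, i ≠ eX → d (X.2 i) = d (B.2 i)) (hcY : ∀ i, i ≠ eY → d (Y.2 i) = d (B.2 i))
    (hcW : ∀ i, i ≠ eW → d (W.2 i) = d (B.2 i))
    (hδX : d (B.2 eX) < d (X.2 eX)) (hδY : d (B.2 eY) < d (Y.2 eY)) (hδW : d (B.2 eW) < d (W.2 eW))
    {h a b c : Fin m}
    (hhX : ¬ (X.1 h = B.1 h ∧ X.2 h = B.2 h)) (hhY : ¬ (Y.1 h = B.1 h ∧ Y.2 h = B.2 h)) (hhW : ¬ (W.1 h = B.1 h ∧ W.2 h = B.2 h))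
    (haX : X.1 a = B.1 a ∧ X.2 a = B.2 a) (haY : ¬ (Y.1 a = B.1 a ∧ Y.2 a = B.2 a)) (haW : ¬ (W.1 a = B.1 a ∧ W.2 a = B.2 a))
    (hbX : ¬ (X.1 b = B.1 b ∧ X.2 b = B.2 b)) (hbY : Y.1 b = B.1 b ∧ Y.2 b = B.2 b) (hbW : ¬ (W.1 b = B.1 b ∧ W.2 b = B.2 b))
    (hcX' : ¬ (X.1 c = B.1 c ∧ X.2 c = B.2 c)) (hcY' : ¬ (Y.1 c = B.1 c ∧ Y.2 c = B.2 c)) (hcW' : W.1 c = B.1 c ∧ W.2 c = B.2 c) :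
    False := by
  have hWha : (B.1⁻¹ * W.1).SameCycle h a :=
    (sameCycle_token d v ε hB hW eW hcW hδW hhW).trans (sameCycle_token d v ε hB hW eW hcW hδW haW).symm
  have hWhb : (B.1⁻¹ * W.1).SameCycle h b :=
    (sameCycle_token d v ε hB hW eW hcW hδW hhW).trans (sameCycle_token d v ε hB hW eW hcW hδW hbW).symm
  have hab : a ≠ b := fun hh => hbX (hh ▸ haX)
  rcases cyc_total (B.1⁻¹ * W.1) hWha hWhb hab with h1 | h1
  · exact four_point_aux d v ε hB hX hY hW eX eY eW hcX hcY hcW hδX hδY hδW hhX hhY hhW haX haY hbX hbY hbW hcX' hcY' hcW' h1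
  · exact four_point_aux d v ε hB hY hX hW eY eX eW hcY hcX hcW hδY hδX hδW hhY hhX hhW hbY hbX haY haX haW hcY' hcX' hcW' h1

/-- **THE HUB LAW** (finite families).  Any nonempty finite family of single-token activations over a common unique-optimum base `B` has a
column at which ALL of them deviate from `B`: the exchange cycles of all activations over a state pass through one common column.  Induction on
the size: 1, 2, 3 activations by `dev_token`, `contact_nonempty`, `three_contact`; for ≥ 4, hubs of the subfamilies missing one activation each
would give the configuration excluded by `four_point`. [this cell] -/
theorem hub {ι : Type*} [DecidableEq ι] {θB : ℤ} (θ : ι → ℤ) {B : Equiv.Perm (Fin m) × (Fin m → Fin K)}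
    (P : ι → Equiv.Perm (Fin m) × (Fin m → Fin K)) (hB : IsDominant d v ε θB B) (hP : ∀ j, IsDominant d v ε (θ j) (P j))
    (e : ι → Fin m) (hc : ∀ j i, i ≠ e j → d ((P j).2 i) = d (B.2 i)) (hδ : ∀ j, d (B.2 (e j)) < d ((P j).2 (e j))) :
    ∀ (s : Finset ι), s.Nonempty → ∃ col, ∀ j ∈ s, ¬ ((P j).1 col = B.1 col ∧ (P j).2 col = B.2 col) := by
  intro s
  induction s using Finset.strongInduction with
  | H s ih =>
    intro hs
    by_cases h4 : s.card ≤ 3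
    · -- one, two or three activations
      rcases Nat.lt_or_ge s.card 2 with h1 | h2
      · have hc1 : s.card = 1 := by have := hs.card_pos; omega
        obtain ⟨x, hx⟩ := Finset.card_eq_one.1 hc1
        refine ⟨e x, fun j hj => ?_⟩
        rw [hx, mem_singleton] at hj
        subst hj
        exact dev_token d (e j) (hδ j)
      rcases Nat.lt_or_ge s.card 3 with h2' | h3
      · have hc2 : s.card = 2 := by omega
        obtain ⟨x, y, hxy, hs2⟩ := Finset.card_eq_two.1 hc2
        obtain ⟨col, h1, h2⟩ := contact_nonempty d v ε hB (hP x) (hP y) (e x) (e y) (hc x) (hc y) (hδ x) (hδ y)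
        refine ⟨col, fun j hj => ?_⟩
        rw [hs2, mem_insert, mem_singleton] at hj
        rcases hj with rfl | rfl
        · exact h1
        · exact h2
      · have hc3 : s.card = 3 := by omega
        obtain ⟨x, y, z, hxy, hxz, hyz, hs3⟩ := Finset.card_eq_three.1 hc3
        obtain ⟨col, h1, h2, h3'⟩ := three_contact d v ε hB (hP x) (hP y) (hP z) (e x) (e y) (e z) (hc x) (hc y) (hc z)
          (hδ x) (hδ y) (hδ z)
        refine ⟨col, fun j hj => ?_⟩
        rw [hs3, mem_insert, mem_insert, mem_singleton] at hj
        rcases hj with rfl | rfl | rfl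
        · exact h1
        · exact h2
        · exact h3'
    · -- four or more: hubs of the subfamilies `s ∖ {j}`
      push Not at h4
      by_contra hno
      push Not at hno
      have hsub : ∀ x ∈ s, ∃ col, (∀ j ∈ s.erase x, ¬ ((P j).1 col = B.1 col ∧ (P j).2 col = B.2 col)) ∧
          ((P x).1 col = B.1 col ∧ (P x).2 col = B.2 col) := by
        intro x hx
        have hne : (s.erase x).Nonempty := by
          rw [← Finset.card_pos, Finset.card_erase_of_mem hx]; omega
        obtain ⟨col, hcol⟩ := ih (s.erase x) (Finset.erase_ssubset hx) hne
        refine ⟨col, hcol, ?_⟩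
        by_contra hx'
        obtain ⟨j, hj, hjcol⟩ := hno col
        rcases eq_or_ne j x with rfl | hjx
        · exact hx' hjcol
        · exact hcol j (Finset.mem_erase.2 ⟨hjx, hj⟩) hjcol
      -- four distinct members
      obtain ⟨x, hx⟩ := hs
      obtain ⟨y, hy⟩ : (s.erase x).Nonempty := by rw [← Finset.card_pos, Finset.card_erase_of_mem hx]; omega
      obtain ⟨z, hz⟩ : ((s.erase x).erase y).Nonempty := by
        rw [← Finset.card_pos, Finset.card_erase_of_mem hy, Finset.card_erase_of_mem hx]; omega
      obtain ⟨w, hw⟩ : (((s.erase x).erase y).erase z).Nonempty := by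
        rw [← Finset.card_pos, Finset.card_erase_of_mem hz, Finset.card_erase_of_mem hy, Finset.card_erase_of_mem hx]; omega
      simp only [Finset.mem_erase] at hy hz hw
      obtain ⟨hyx, hy⟩ := hy
      obtain ⟨hzy, hzx, hz⟩ := hz
      obtain ⟨hwz, hwy, hwx, hw⟩ := hw
      obtain ⟨hh, hhs, hhy⟩ := hsub y hy
      obtain ⟨ha, has, hax⟩ := hsub x hx
      obtain ⟨hb, hbs, hbz⟩ := hsub z hz
      obtain ⟨hcc, hcs, hcw⟩ := hsub w hw
      have mem : ∀ {j k : ι}, j ∈ s → j ≠ k → j ∈ s.erase k := fun hj hjk => Finset.mem_erase.2 ⟨hjk, hj⟩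
      exact four_point d v ε hB (hP x) (hP z) (hP w) (e x) (e z) (e w) (hc x) (hc z) (hc w) (hδ x) (hδ z) (hδ w)
        (hhs x (mem hx hyx.symm)) (hhs z (mem hz hzy)) (hhs w (mem hw hwy))
        hax (has z (mem hz hzx)) (has w (mem hw hwx))
        (hbs x (mem hx hzx.symm)) hbz (hbs w (mem hw hwz))
        (hcs x (mem hx hwx.symm)) (hcs z (mem hz hwz.symm)) hcw

/-- **THE HUB LAW** (whole index type). [this cell] -/
theorem hub_law {ι : Type*} [Fintype ι] [DecidableEq ι] [Nonempty ι] {θB : ℤ} (θ : ι → ℤ)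
    {B : Equiv.Perm (Fin m) × (Fin m → Fin K)} (P : ι → Equiv.Perm (Fin m) × (Fin m → Fin K))
    (hB : IsDominant d v ε θB B) (hP : ∀ j, IsDominant d v ε (θ j) (P j))
    (e : ι → Fin m) (hc : ∀ j i, i ≠ e j → d ((P j).2 i) = d (B.2 i)) (hδ : ∀ j, d (B.2 (e j)) < d ((P j).2 (e j))) :
    ∃ col, ∀ j, ¬ ((P j).1 col = B.1 col ∧ (P j).2 col = B.2 col) := by
  obtain ⟨col, hcol⟩ := hub d v ε θ P hB hP e hc hδ univ univ_nonempty
  exact ⟨col, fun j => hcol j (mem_univ j)⟩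

end Hub

end SingleContact

end Summit.ValiantsHypothesis.ValiantsHypothesis.Theorems.KPlusLogSqLaw
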